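import Summits.RiemannHypothesis.RiemannHypothesis.Theorems.IntegerScrewScrewPolyFloorLandauTailIntegral
import HarnessLib

/-!
# Route IntegerScrew — the RH-free tail floor from height `M³` (exponent `3`)

Helper file for crux `IntegerScrew.ScrewPolyFloor` (stmt-RiemannHypothesis-15757), idea card
`Cruxes/ScrewPolyFloor/Ideas/abscissa-blind-head.md`. Sharp form of `tailFloor`
(`IntegerScrewScrewPolyFloorLandauTailFloor.lean`, height `M¹⁶`, `c = 1/24`): for `M ≥ M₀` and every
real `y` on `[1, M]` with `∑ y_m = 0`,

  `(1/2π)·(log M)/M³ · ∑ y_m² ≤ (screw form of y) − Re ∑_{|Im ρ| ≤ M³} m(ρ)(−P_y(ρ−½)P_y(½−ρ))/(ρ−½)²`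

(`tailFloor_sharp`): the zeros ABOVE height `M³`, in the unconditional expansion `hasSum_screwForm`,
pay the floor `(log M)/(2π M³)` with no hypothesis on the zeros of `ζ`. Proof: `tail_window_lower`
(Abel summation in integral form against `pairing_window_positive_sharp`, far-zero correction by
`KadiriTail.sum_far_le`) on `M³ < |Im ρ| ≤ U`, the arithmetic of `T₀ = M³`
(`a = 2 log M − log 2π − 1 ≥ log M`, errors `≪ (C + 1) M^{5/2} log²M / M⁶ ≤ (log M)/(4π M³)` once
`M^{1/4} ≫ C + 1`, via `log M ≤ 4 M^{1/4}`), and `U → ∞` along `U_n = (n+1) M³`.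
-/

noncomputable section

open Complex Finset Filter Topology
open scoped Real

-- the layout-mandated namespace repeats the summit name
set_option linter.dupNamespace false

namespace Summit.RiemannHypothesis.RiemannHypothesis.Theorems.IntegerScrewLandau

open Literature.NumberTheory.LFunctions

/-! ### Kadiri's tail bound at `t = 0` -/

/-- Kadiri's tail bound at `t = 0`: `B(0, T₀) ≤ 111 log T₀/T₀` for `T₀ ≥ 1` with `log T₀ ≥ 9`
(`log 7 ≤ 2`; cf. `TaoTeravainen.log_seven_le_two`). [folklore] -/
theorem tailBound_zero_le {T₀ : ℝ} (h1 : 1 ≤ T₀) (hlog : 9 ≤ Real.log T₀) :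
    KadiriTail.tailBound 0 T₀ ≤ 111 * Real.log T₀ / T₀ := by
  unfold KadiriTail.tailBound
  have hT0 : 0 < T₀ := by linarith
  have h7 : Real.log (0 + 7) ≤ 2 := by
    rw [zero_add, Real.log_le_iff_le_exp (by positivity)]
    have he := Real.exp_one_gt_d9
    have h2 : Real.exp 2 = Real.exp 1 ^ 2 := by rw [← Real.exp_nat_mul]; norm_num
    nlinarith
  have hinv : 1 / T₀ ^ 2 ≤ 1 / T₀ := by
    rw [div_le_div_iff₀ (by positivity) hT0, one_mul, one_mul]; nlinarith
  have hl0 : 0 ≤ Real.log T₀ := by linarith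
  have h1' : Real.log T₀ / T₀ ^ 2 ≤ Real.log T₀ / T₀ :=
    div_le_div_of_nonneg_left hl0 hT0 (by nlinarith)
  calc (154 + 30 * Real.log (0 + 7)) * (1 / T₀ ^ 2 + 1 / T₀) +
        30 * (Real.log T₀ / T₀ ^ 2 + (Real.log T₀ + 1) / T₀)
      ≤ (154 + 30 * 2) * (1 / T₀ + 1 / T₀) + 30 * (Real.log T₀ / T₀ + (Real.log T₀ + 1) / T₀) := by
        gcongr
    _ = (458 + 60 * Real.log T₀) / T₀ := by field_simp; ring
    _ ≤ 111 * Real.log T₀ / T₀ := by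
        refine div_le_div_of_nonneg_right ?_ hT0.le
        linarith

/-! ### The tail floor -/

set_option maxHeartbeats 1600000 in
/-- **TailFloor, sharp (RH-free, height `M³`).** There is `M₀` such that for every `M ≥ M₀` and
every real vector `y` on `[1, M]` with `∑_{m ≤ M} y_m = 0`,
`(1/2π)·(log M)/M³·∑ y_m² ≤ (∑_{2≤m,m'≤M} G(log m, log m') y_m y_m') − Re ∑_{|Im ρ| ≤ M³} m(ρ)(−P_y(ρ−½)P_y(−(ρ−½)))/(ρ−½)²`
— the zeros above height `M³`, in the unconditional expansion of the screw form (`hasSum_screwForm`),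
pay the polynomial floor `(log M)/(2π M³)`; no hypothesis on the zeros of `ζ`. [folklore] -/
theorem tailFloor_sharp :
    ∃ (c : ℝ) (M₀ : ℕ), 0 < c ∧ ∀ M : ℕ, M₀ ≤ M → ∀ y : ℕ → ℝ, ∑ m ∈ Icc 1 M, y m = 0 →
      c * Real.log M / (M : ℝ) ^ 3 * ∑ m ∈ Icc 1 M, y m ^ 2 ≤
        (∑ m ∈ Icc 2 M, ∑ m' ∈ Icc 2 M,
            zetaScrewKernel (Real.log m) (Real.log m') * (y m * y m')) -
          (∑ ρ ∈ SchoenfeldBound.zerosUpTo ((M : ℝ) ^ 3),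
            (riemannZetaZeroOrder (ρ : ℂ) : ℂ) *
              (-((∑ m ∈ Icc 1 M, ((y m : ℝ) : ℂ) * (m : ℂ) ^ ((ρ : ℂ) - 1 / 2)) *
                  ∑ m ∈ Icc 1 M, ((y m : ℝ) : ℂ) * (m : ℂ) ^ (-((ρ : ℂ) - 1 / 2))) /
                ((ρ : ℂ) - 1 / 2) ^ 2)).re := by
  obtain ⟨CP, TP, hCP0, -, hpos⟩ := pairing_window_positive_sharp
  set Kc : ℝ := 42 * CP + 1998 with hKc
  have hKc0 : 0 < Kc := by positivity
  refine ⟨1 / (2 * π), max 21 (max (⌈TP⌉₊ + 1) (⌈(51 * Kc) ^ 4⌉₊ + 1)), by positivity,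
    fun M hM y hy0 ↦ ?_⟩
  classical
  -- the size of `M`
  have hM21n : 21 ≤ M := le_trans (le_max_left _ _) hM
  have hM1 : 1 ≤ M := le_trans (by norm_num) hM21n
  have hM21 : (21 : ℝ) ≤ M := by exact_mod_cast hM21n
  have hM0 : (0 : ℝ) < M := by linarith
  have hMr1 : (1 : ℝ) ≤ M := by linarith
  have hceil : ∀ {x : ℝ} {n : ℕ}, ⌈x⌉₊ + 1 ≤ n → x ≤ (n : ℝ) := fun {x n} h ↦ by
    have h1 : x ≤ ⌈x⌉₊ := Nat.le_ceil x
    have h2 : ((⌈x⌉₊ + 1 : ℕ) : ℝ) ≤ n := by exact_mod_cast h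
    push_cast at h2
    linarith
  have hTPM : TP ≤ (M : ℝ) := hceil ((le_max_left _ _).trans ((le_max_right _ _).trans hM))
  have hQM : (51 * Kc) ^ 4 ≤ (M : ℝ) := hceil ((le_max_right _ _).trans ((le_max_right _ _).trans hM))
  set L : ℝ := Real.log (M : ℝ) with hL
  have hL3 : 3 ≤ L := by
    -- `e³ < 20.1 ≤ 21 ≤ M` (cf. `VKFromRichert.three_le_log_of_ge`)
    rw [hL, Real.le_log_iff_exp_le hM0]
    have he := Real.exp_one_lt_d9
    have he0 := Real.exp_pos 1
    have h3 : Real.exp 3 = Real.exp 1 ^ 3 := by rw [← Real.exp_nat_mul]; norm_num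
    have h4 : Real.exp 1 ^ 3 < (2.7182818286 : ℝ) ^ 3 := pow_lt_pow_left₀ he he0.le three_ne_zero
    have h5 : (2.7182818286 : ℝ) ^ 3 < 21 := by norm_num
    rw [h3]
    linarith
  have hL0 : 0 ≤ L := by linarith
  -- the parameters
  set S : ℝ := ∑ m ∈ Icc 1 M, y m ^ 2 with hS
  have hS0 : 0 ≤ S := Finset.sum_nonneg fun _ _ ↦ sq_nonneg _
  set T₀ : ℝ := (M : ℝ) ^ 3 with hT₀
  have hT₀M : (M : ℝ) ≤ T₀ := by
    rw [hT₀]; nlinarith [one_le_pow₀ (n := 2) hMr1]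
  have hT₀P : TP ≤ T₀ := hTPM.trans hT₀M
  have hT₀4 : 4 ≤ T₀ := le_trans (by linarith) hT₀M
  have hT₀0 : 0 < T₀ := by linarith
  have hT₀1 : 1 ≤ T₀ := by linarith
  have hℓ₀ : Real.log T₀ = 3 * L := by rw [hT₀, hL, Real.log_pow]; norm_num
  -- `a ≥ L`
  have haL : L ≤ Real.log (T₀ / (2 * π)) - L - 1 := by
    have e : Real.log (T₀ / (2 * π)) = 3 * L - Real.log (2 * π) := by
      rw [Real.log_div hT₀0.ne' (by positivity), hℓ₀]
    rw [e]
    linarith [LittlewoodAverage.log_two_pi_le_two]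
  -- `√M ≥ 4π Kc L` via `log M ≤ 4 M^{1/4}`
  set s : ℝ := Real.sqrt (Real.sqrt M) with hs
  have hs0 : 0 ≤ s := Real.sqrt_nonneg _
  have hsq : Real.sqrt M = s ^ 2 := (Real.sq_sqrt (Real.sqrt_nonneg _)).symm
  have hsQ : 51 * Kc ≤ s := by
    have h1 : Real.sqrt ((51 * Kc) ^ 4) ≤ Real.sqrt M := Real.sqrt_le_sqrt hQM
    have e1 : Real.sqrt ((51 * Kc) ^ 4) = (51 * Kc) ^ 2 := by
      rw [show (51 * Kc) ^ 4 = ((51 * Kc) ^ 2) ^ 2 by ring, Real.sqrt_sq (by positivity)]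
    rw [e1] at h1
    have h2 : Real.sqrt ((51 * Kc) ^ 2) ≤ s := Real.sqrt_le_sqrt h1
    rwa [Real.sqrt_sq (by positivity)] at h2
  have hLs : L ≤ 4 * s := by
    have hspos : 0 < s := lt_of_lt_of_le (by positivity) hsQ
    have h1 := Real.log_le_sub_one_of_pos hspos
    have e : Real.log s = L / 4 := by
      rw [hs, Real.log_sqrt (Real.sqrt_nonneg _), Real.log_sqrt hM0.le, hL]; ring
    rw [e] at h1
    linarith
  have hkey : 4 * π * Kc * L ≤ Real.sqrt M := by
    have hπ4 : 4 * π ≤ 51 / 4 := by linarith [Real.pi_lt_d2]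
    calc 4 * π * Kc * L ≤ 51 / 4 * Kc * (4 * s) := by gcongr
      _ = (51 * Kc) * s := by ring
      _ ≤ s * s := mul_le_mul_of_nonneg_right hsQ hs0
      _ = Real.sqrt M := by rw [hsq, sq]
  -- the summand and the expansion
  set F : NicolasJExplicit.Zeros → ℂ := fun ρ ↦ (riemannZetaZeroOrder (ρ : ℂ) : ℂ) *
    (-((∑ m ∈ Icc 1 M, ((y m : ℝ) : ℂ) * (m : ℂ) ^ ((ρ : ℂ) - 1 / 2)) *
        ∑ m ∈ Icc 1 M, ((y m : ℝ) : ℂ) * (m : ℂ) ^ (-((ρ : ℂ) - 1 / 2))) /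
      ((ρ : ℂ) - 1 / 2) ^ 2) with hF
  set SF : ℝ := ∑ m ∈ Icc 2 M, ∑ m' ∈ Icc 2 M,
    zetaScrewKernel (Real.log m) (Real.log m') * (y m * y m') with hSF
  have hsum : HasSum F (SF : ℂ) := hasSum_screwForm M hM1 y hy0
  set U : ℕ → ℝ := fun n ↦ T₀ * ((n : ℝ) + 1) with hU
  set H : ℕ → ℂ := fun n ↦ ∑ ρ ∈ SchoenfeldBound.zerosUpTo (U n), F ρ with hH
  have hUge : ∀ n, T₀ ≤ U n := fun n ↦ by
    simp only [hU]
    have : (0 : ℝ) ≤ n := Nat.cast_nonneg n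
    nlinarith
  have hUmono : Monotone U := fun i j hij ↦ by
    simp only [hU]
    have : (i : ℝ) ≤ j := by exact_mod_cast hij
    nlinarith
  -- (i) the head sums converge to the screw form
  have hfin : Tendsto (fun n ↦ SchoenfeldBound.zerosUpTo (U n)) atTop atTop := by
    refine tendsto_atTop_finset_of_monotone
      (fun i j hij ↦ SchoenfeldBound.zerosUpTo_subset (hUmono hij)) ?_
    intro ρ
    refine ⟨⌈|(ρ : ℂ).im| / T₀⌉₊, ?_⟩
    rw [SchoenfeldBound.mem_zerosUpTo]
    simp only [hU]
    have h1 : |(ρ : ℂ).im| / T₀ ≤ ⌈|(ρ : ℂ).im| / T₀⌉₊ := Nat.le_ceil _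
    rw [div_le_iff₀ hT₀0] at h1
    nlinarith [abs_nonneg ((ρ : ℂ).im)]
  have hlim : Tendsto H atTop (𝓝 (SF : ℂ)) := by
    have h := hsum
    rw [HasSum] at h
    simp only [SummationFilter.unconditional_filter] at h
    exact h.comp hfin
  -- (ii) the finite tails
  have htail : ∀ n : ℕ, 3 ≤ n → 1 / (2 * π) * L / T₀ * S ≤ (H n - H 0).re := by
    intro n hn
    have hUn : 4 * T₀ ≤ U n := by
      simp only [hU]
      have : (3 : ℝ) ≤ n := by exact_mod_cast hn
      nlinarith
    have hU0 : 0 < U n := by linarith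
    have hHdiff : H n - H 0 =
        ∑ ρ ∈ SchoenfeldBound.zerosUpTo (U n) \ SchoenfeldBound.zerosUpTo T₀, F ρ := by
      simp only [hH]
      have e0 : U 0 = T₀ := by simp [hU]
      rw [e0, Finset.sum_sdiff_eq_sub (SchoenfeldBound.zerosUpTo_subset (hUge n))]
    rw [hHdiff]
    have hW := tail_window_lower hCP0.le hpos hM1 y hT₀P hT₀4 (hUge n)
    rw [← hL, hℓ₀] at hW
    refine le_trans (mul_le_mul_of_nonneg_right ?_ hS0) hW
    -- pieces, in terms of `t = L/(π T₀)` and `r = M^{5/2} L²/T₀²`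
    set t : ℝ := L / (π * T₀) with ht
    set r : ℝ := (M : ℝ) ^ 2 * Real.sqrt M * L ^ 2 / T₀ ^ 2 with hr
    have hπ0 : 0 < π := Real.pi_pos
    have hmainT : 3 / 4 * t ≤ (Real.log (T₀ / (2 * π)) - L - 1) / π * (1 / T₀ - 1 / U n) := by
      have h1 : 1 / U n ≤ 1 / (4 * T₀) := one_div_le_one_div_of_le (by positivity) hUn
      have h2 : 3 / 4 * (1 / T₀) ≤ 1 / T₀ - 1 / U n := by
        have : 1 / (4 * T₀) = 1 / 4 * (1 / T₀) := by field_simp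
        linarith
      have h3 : 0 ≤ (Real.log (T₀ / (2 * π)) - L - 1) / π := div_nonneg (hL0.trans haL) hπ0.le
      calc 3 / 4 * t = L / π * (3 / 4 * (1 / T₀)) := by rw [ht]; field_simp
        _ ≤ (Real.log (T₀ / (2 * π)) - L - 1) / π * (3 / 4 * (1 / T₀)) := by gcongr
        _ ≤ (Real.log (T₀ / (2 * π)) - L - 1) / π * (1 / T₀ - 1 / U n) :=
            mul_le_mul_of_nonneg_left h2 h3
    have hlam : Real.log (3 * (M : ℝ)) ≤ 2 * L := by
      rw [Real.log_mul (by norm_num) hM0.ne', ← hL]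
      have : Real.log 3 ≤ 2 := by
        rw [Real.log_le_iff_le_exp (by norm_num)]
        have he := Real.exp_one_gt_d9
        have h2 : Real.exp 2 = Real.exp 1 ^ 2 := by rw [← Real.exp_nat_mul]; norm_num
        nlinarith
      linarith
    have hE0 : 0 ≤ (M : ℝ) ^ 2 * Real.sqrt M := by positivity
    have herr1 : 2 * CP * (M : ℝ) ^ 2 * Real.sqrt M * (2 * (3 * L) ^ 2 + Real.log (3 * (M : ℝ)) + 16) /
        T₀ ^ 2 ≤ 42 * CP * r := by
      have h1 : 2 * (3 * L) ^ 2 + Real.log (3 * (M : ℝ)) + 16 ≤ 21 * L ^ 2 := by nlinarith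
      calc 2 * CP * (M : ℝ) ^ 2 * Real.sqrt M * (2 * (3 * L) ^ 2 + Real.log (3 * (M : ℝ)) + 16) / T₀ ^ 2
          = (2 * CP * ((M : ℝ) ^ 2 * Real.sqrt M)) * (2 * (3 * L) ^ 2 + Real.log (3 * (M : ℝ)) + 16) /
              T₀ ^ 2 := by ring
        _ ≤ (2 * CP * ((M : ℝ) ^ 2 * Real.sqrt M)) * (21 * L ^ 2) / T₀ ^ 2 := by gcongr
        _ = 42 * CP * r := by rw [hr]; ring
    have htB : KadiriTail.tailBound 0 T₀ ≤ 111 * (3 * L) / T₀ := by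
      rw [← hℓ₀]; exact tailBound_zero_le hT₀1 (by rw [hℓ₀]; linarith)
    have hsqM1 : 1 ≤ Real.sqrt M := by
      rw [show (1 : ℝ) = Real.sqrt 1 by simp]; exact Real.sqrt_le_sqrt hMr1
    have htB0 : 0 ≤ KadiriTail.tailBound 0 T₀ := KadiriTail.tailBound_nonneg le_rfl hT₀1
    have herr2 : 6 * (M : ℝ) ^ 2 * KadiriTail.tailBound 0 T₀ / T₀ ≤ 1998 * r := by
      have hL1 : 1 ≤ L := by linarith
      have s3 : (M : ℝ) ^ 2 * L ≤ (M : ℝ) ^ 2 * Real.sqrt M * L ^ 2 := by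
        have h := mul_le_mul hsqM1 hL1 zero_le_one (Real.sqrt_nonneg _)
        have h' : 0 ≤ (M : ℝ) ^ 2 * L := by positivity
        calc (M : ℝ) ^ 2 * L = (M : ℝ) ^ 2 * L * (1 * 1) := by ring
          _ ≤ (M : ℝ) ^ 2 * L * (Real.sqrt M * L) := mul_le_mul_of_nonneg_left h h'
          _ = (M : ℝ) ^ 2 * Real.sqrt M * L ^ 2 := by ring
      calc 6 * (M : ℝ) ^ 2 * KadiriTail.tailBound 0 T₀ / T₀
          ≤ 6 * (M : ℝ) ^ 2 * (111 * (3 * L) / T₀) / T₀ := by gcongr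
        _ = 1998 * ((M : ℝ) ^ 2 * L) / T₀ ^ 2 := by field_simp; ring
        _ ≤ 1998 * ((M : ℝ) ^ 2 * Real.sqrt M * L ^ 2) / T₀ ^ 2 := by gcongr
        _ = 1998 * r := by rw [hr]; ring
    have herr : Kc * r ≤ 1 / 4 * t := by
      rw [hr, ht]
      -- `4π Kc M²√M L ≤ T₀ = M³`
      have h1 : 4 * π * Kc * L * ((M : ℝ) ^ 2 * Real.sqrt M) ≤ T₀ := by
        calc 4 * π * Kc * L * ((M : ℝ) ^ 2 * Real.sqrt M) ≤ Real.sqrt M * ((M : ℝ) ^ 2 * Real.sqrt M) :=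
              mul_le_mul_of_nonneg_right hkey hE0
          _ = (M : ℝ) ^ 2 * (Real.sqrt M * Real.sqrt M) := by ring
          _ = T₀ := by rw [Real.mul_self_sqrt hM0.le, hT₀]; ring
      rw [mul_div_assoc', div_le_iff₀ (by positivity), show 1 / 4 * (L / (π * T₀)) * T₀ ^ 2 =
        L * (T₀ / (4 * π)) by field_simp]
      have h2 : Kc * ((M : ℝ) ^ 2 * Real.sqrt M * L ^ 2) = (L * (Kc * L * ((M : ℝ) ^ 2 * Real.sqrt M))) := by
        ring
      rw [h2]
      have h3 : Kc * L * ((M : ℝ) ^ 2 * Real.sqrt M) ≤ T₀ / (4 * π) := by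
        rw [le_div_iff₀ (by positivity)]
        nlinarith [h1]
      exact mul_le_mul_of_nonneg_left h3 hL0
    have hsumErr : 2 * CP * (M : ℝ) ^ 2 * Real.sqrt M * (2 * (3 * L) ^ 2 + Real.log (3 * (M : ℝ)) + 16) /
          T₀ ^ 2 + 6 * (M : ℝ) ^ 2 * KadiriTail.tailBound 0 T₀ / T₀ ≤ 1 / 4 * t := by
      calc _ ≤ 42 * CP * r + 1998 * r := add_le_add herr1 herr2
        _ = Kc * r := by rw [hKc]; ring
        _ ≤ 1 / 4 * t := herr
    have e3 : 1 / (2 * π) * L / T₀ = 1 / 2 * t := by rw [ht]; field_simp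
    rw [e3]
    linarith [hmainT, hsumErr]
  -- (iii) the limit
  have hlimre : Tendsto (fun n ↦ (H n - H 0).re) atTop (𝓝 (((SF : ℂ) - H 0).re)) :=
    (Complex.continuous_re.tendsto _).comp (hlim.sub_const (H 0))
  have hge : 1 / (2 * π) * L / T₀ * S ≤ ((SF : ℂ) - H 0).re :=
    ge_of_tendsto hlimre (Filter.eventually_atTop.2 ⟨3, htail⟩)
  have hH0 : H 0 = ∑ ρ ∈ SchoenfeldBound.zerosUpTo ((M : ℝ) ^ 3), F ρ := by
    simp only [hH, hU, hT₀, Nat.cast_zero, zero_add, mul_one]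
  rw [Complex.sub_re, Complex.ofReal_re, hH0] at hge
  have e : 1 / (2 * π) * Real.log M / (M : ℝ) ^ 3 * S = 1 / (2 * π) * L / T₀ * S := by
    simp only [hL, hT₀]
  rw [e]
  exact hge

end Summit.RiemannHypothesis.RiemannHypothesis.Theorems.IntegerScrewLandau

end
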